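import Literature.MeasureTheory.Group.QuotientOrbitalIntegralProperSmoothParam   -- ★ (HYP-PARAM): `descConj`, `continuous_quotient_liftOn'_of_forall_mul_mem`, the Hörmander engine
import HarnessLib

/-!
# Uniform properness modulo `M` + a fibre `Y` riding along ⇒ the quotient orbital integral with an extra fibre integration is `C^∞` in (chart point, parameter) «(A4-gen)»

Generic measure-theory support file (THEOREMS ONLY; no `def`, no instance, no `sorry`), namespace `Literature.MeasureTheory.Group`; the FIBRED twin of ★ (HYP-PARAM)
`contDiffOn_integral_descConj_of_uniformlyProper_param_local` (`QuotientOrbitalIntegralProperSmoothParam.lean`).  Cell `pub/hodgecm-mathlib`, crux H413 (`stmt-HodgeConjecture-24833`),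
line LH3 letter L1 clause (I₂), RULING #13 brick **(A4) THE SMOOTH MODEL** (LH3-plan (g3) 2026-09-02T09:57:12Z; spec F0P3b-p01 (g16) `SPEC-E3-assembly.v1.md` §1 (A4)): this is its
GENERIC layer (no `U(J)` token), dealt to seat LH5-p02 (g3).  Count-neutral.

THE MATHEMATICS.  As in (HYP-PARAM): `G` a topological group, `M ≤ G`, a chart `c : V → G` of elements commuting with `M` on a finite-dimensional real `V`, `S ⊆ V` open with the
uniform properness (HYP) of `(x, yM) ↦ y · c(x) · y⁻¹` on compacts of `S`; a finite-dimensional parameter space `Z`, `T ⊆ Z` open.  NEW: a FIBRE `Y` (a Hausdorff second-countable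
space with a measure `λ` finite on compacta — in (A4): `Y = Π_{w ∈ S′} (K_w × N_w)`, the unfolded variables of the split places) and a fibred family of test kernels
`Φ : V × Z → G → Y → F` which (i) vanishes for `g` off ONE compact `C ⊆ G` (`q ∈ S ×ˢ T`), (ii) vanishes for `η` off a compact `Y₀(K)` uniformly for `q` in any compact `K ⊆ S ×ˢ T`
(in (A4): `HasCompactSupport a′`, `K_w` compact, `N_w` closed, movers bounded on compacts — exactly ★ (e3-4b) §1), and (iii) factors smoothly,
`Φ q (y · c(q.1) · y⁻¹) η = Ψ ((p y, r η), q)` with `p : G → P` continuous `M`-right-invariant, `r : Y → Q` continuous, `Ψ : (P × Q) × (V × Z) → F` of class `C^∞` (`P`, `Q` normed).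
Then **`q = (x, z) ↦ ∫_{(G ⧸ M) × Y} Φ q (y · c(x) · y⁻¹) η d(μ ⊗ λ)(yM, η)` is `C^∞` on `S ×ˢ T`** for every `μ` on `G ⧸ M` finite on compacta: near `q₀` take compact neighbourhoods
`K ⊆ S`, `K_T ⊆ T`; by (HYP) and (ii) the integrands for `q ∈ K × K_T` are supported in ONE compact `𝒦 × Y₀` of `(G ⧸ M) × Y`, and the tree's Hörmander engine ★
`Literature.Analysis.Calculus.contDiffAt_integral_comp_of_contDiff_of_support` differentiates under the integral sign on the product space — ONE call, NO Fubini, no integrability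
side-goal (the fibre is never integrated out separately).
* `contDiffOn_integral_prod_descConj_fibre_of_uniformlyProper_local` — `Z`-local form (`z ∈ T` open);
* `contDiffOn_integral_prod_descConj_fibre_of_uniformlyProper` — `T = univ`;
* `contDiffOn_integral_prod_descConj_fibre_of_uniformlyProper_of_param` — no parameter (`Φ : V → G → Y → F`): `C^∞` on `S`.
HONEST LABEL: HC_CM is proved only modulo the printed citations (2 remaining named inputs: hLiu418 = `stmt-HodgeConjecture-24832`, h413 = `stmt-HodgeConjecture-24833`) until
rung 0 closes; count-neutral.

## References
* [HormanderALPDO1] L. Hörmander, *The Analysis of Linear Partial Differential Operators I*, 2nd ed. (1990), §1.1 Thm. 1.1.9 (p. 12) (differentiation under the integral sign).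
* [DeitmarEchterhoff2014] A. Deitmar, S. Echterhoff, *Principles of Harmonic Analysis*, 2nd ed. (2014), Lemma 9.3.3.
* [Varadarajan1977] V. S. Varadarajan, *Harmonic Analysis on Real Reductive Groups*, LNM 576 (1977), Part I §1.12 (parabolic unfolding of `'F_f`).
-/

set_option autoImplicit false

noncomputable section

open MeasureTheory MeasureTheory.Measure Set Topology Filter
open scoped ContDiff

namespace Literature.MeasureTheory.Group

section FibreSmoothParam

variable {G : Type*} [Group G] [TopologicalSpace G]
  {V : Type*} [NormedAddCommGroup V] [NormedSpace ℝ V] [FiniteDimensional ℝ V]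
  {Z : Type*} [NormedAddCommGroup Z] [NormedSpace ℝ Z] [FiniteDimensional ℝ Z]
  {P : Type*} [NormedAddCommGroup P] [NormedSpace ℝ P]
  {Q : Type*} [NormedAddCommGroup Q] [NormedSpace ℝ Q]
  {F : Type*} [NormedAddCommGroup F] [NormedSpace ℝ F] [CompleteSpace F]
  {Y : Type*} [TopologicalSpace Y] [T2Space Y] [SecondCountableTopology Y] [MeasurableSpace Y] [OpensMeasurableSpace Y]

/-- **(A4-gen), `Z`-local form — (HYP-PARAM) WITH A FIBRE RIDING ALONG.**  Uniform properness modulo `M` on compacts of an open `S ⊆ V`; a fibre `Y` with a measure `λ` finite on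
compacta; a fibred family `Φ : V × Z → G → Y → F` vanishing for `g` off one compact `C ⊆ G` (parameters in `S ×ˢ T`, `T` open) and for `η` off a compact `Y₀(K)` uniformly on compacts
`K ⊆ S ×ˢ T`; a smooth factorisation `Φ q (y · c q.1 · y⁻¹) η = Ψ ((p y, r η), q)` through a continuous `M`-right-invariant `p` and a continuous `r` ⇒
**`q ↦ ∫_{(G ⧸ M) × Y} Φ q (y · c(q.1) · y⁻¹) η d(μ ⊗ λ)` is `ContDiffOn ℝ ∞` on `S ×ˢ T`**, for every `μ` on `G ⧸ M` finite on compacta — one Hörmander call on the product space.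
[cite: HormanderALPDO1, §1.1 Thm. 1.1.9 (p. 12)] [cite: DeitmarEchterhoff2014, Lemma 9.3.3] [cite: Varadarajan1977, I §1.12] -/
theorem contDiffOn_integral_prod_descConj_fibre_of_uniformlyProper_local
    (M : Subgroup G) {c : V → G} (hcomm : ∀ x, ∀ m ∈ M, m * c x = c x * m)
    {S : Set V} (hS : IsOpen S)
    (hprop : ∀ K ⊆ S, IsCompact K → ∀ C : Set G, IsCompact C →
      ∃ 𝒦 : Set (G ⧸ M), IsCompact 𝒦 ∧ ∀ x ∈ K, ∀ y : G, y * c x * y⁻¹ ∈ C → (QuotientGroup.mk y : G ⧸ M) ∈ 𝒦)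
    [MeasurableSpace (G ⧸ M)] [OpensMeasurableSpace (G ⧸ M)] [T2Space (G ⧸ M)]
    (μ : Measure (G ⧸ M)) [IsFiniteMeasureOnCompacts μ] (ν : Measure Y) [IsFiniteMeasureOnCompacts ν] [SFinite ν]
    {T : Set Z} (hT : IsOpen T) {Φ : V × Z → G → Y → F} {C : Set G} (hC : IsCompact C)
    (hΦC : ∀ q ∈ S ×ˢ T, ∀ g ∉ C, ∀ η, Φ q g η = 0)
    (hfib : ∀ K ⊆ S ×ˢ T, IsCompact K → ∃ Y₀ : Set Y, IsCompact Y₀ ∧ ∀ q ∈ K, ∀ g, ∀ η ∉ Y₀, Φ q g η = 0)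
    (p : G → P) (hp : Continuous p) (hpM : ∀ y, ∀ m ∈ M, p (y * m) = p y) (r : Y → Q) (hr : Continuous r)
    (Ψ : (P × Q) × (V × Z) → F) (hΨ : ContDiff ℝ ∞ Ψ) (hfac : ∀ q y η, Φ q (y * c q.1 * y⁻¹) η = Ψ ((p y, r η), q)) :
    ContDiffOn ℝ ∞ (fun q : V × Z => ∫ w : (G ⧸ M) × Y, descConj (c q.1) M (hcomm q.1) (fun g => Φ q g w.2) w.1 ∂(μ.prod ν)) (S ×ˢ T) := by
  obtain ⟨pbar, hpbar, hpbar_mk⟩ := continuous_quotient_liftOn'_of_forall_mul_mem M p hp hpM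
  -- the continuous datum on the product space
  have hdat : Continuous fun w : (G ⧸ M) × Y => (pbar w.1, r w.2) := (hpbar.comp continuous_fst).prodMk (hr.comp continuous_snd)
  -- the integrand, read through the factorisation
  have hint : ∀ q : V × Z, (fun w : (G ⧸ M) × Y => descConj (c q.1) M (hcomm q.1) (fun g => Φ q g w.2) w.1) =
      fun w => Ψ ((pbar w.1, r w.2), q) := by
    intro q
    funext w
    obtain ⟨u, η⟩ := w
    induction u using QuotientGroup.induction_on with
    | H y => simp only [descConj_mk, hfac, hpbar_mk]
  have hEq : (fun q : V × Z => ∫ w : (G ⧸ M) × Y, descConj (c q.1) M (hcomm q.1) (fun g => Φ q g w.2) w.1 ∂(μ.prod ν)) =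
      fun q => ∫ w : (G ⧸ M) × Y, Ψ ((fun w : (G ⧸ M) × Y => (pbar w.1, r w.2)) w, q) ∂(μ.prod ν) := by
    funext q
    rw [hint q]
  rw [hEq]
  rintro ⟨x₀, z₀⟩ hq₀
  rw [mem_prod] at hq₀
  -- compact neighbourhoods of `x₀` in `S` and of `z₀` in `T`
  obtain ⟨K, hKnhds, hKsub, hK⟩ := local_compact_nhds (hS.mem_nhds hq₀.1)
  obtain ⟨KT, hKTnhds, hKTsub, hKT⟩ := local_compact_nhds (hT.mem_nhds hq₀.2)
  obtain ⟨𝒦, h𝒦, hmem⟩ := hprop K hKsub hK C hC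
  obtain ⟨Y₀, hY₀, hY₀zero⟩ := hfib (K ×ˢ KT) (prod_mono hKsub hKTsub) (hK.prod hKT)
  have hU : K ×ˢ KT ∈ 𝓝 (x₀, z₀) := prod_mem_nhds hKnhds hKTnhds
  -- off `𝒦 × Y₀` the integrand vanishes, for `q ∈ K × K_T`
  have h0 : ∀ w : (G ⧸ M) × Y, w ∉ 𝒦 ×ˢ Y₀ → ∀ q ∈ K ×ˢ KT, Ψ ((fun w : (G ⧸ M) × Y => (pbar w.1, r w.2)) w, q) = 0 := by
    rintro ⟨u, η⟩ hw ⟨x, z⟩ hq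
    have hq' : (x, z) ∈ S ×ˢ T := prod_mono hKsub hKTsub hq
    rw [mem_prod] at hq
    induction u using QuotientGroup.induction_on with
    | H y =>
      simp only [hpbar_mk]
      rw [← hfac (x, z) y η]
      by_contra hne
      apply hw
      refine mk_mem_prod ?_ ?_
      · have hgC : y * c x * y⁻¹ ∈ C := by
          by_contra hgC
          exact hne (hΦC (x, z) hq' _ hgC η)
        exact hmem x hq.1 y hgC
      · by_contra hη
        exact hne (hY₀zero (x, z) hq _ η hη)
  exact (Literature.Analysis.Calculus.contDiffAt_integral_comp_of_contDiff_of_support (μ.prod ν) Ψ hΨ _ hdat (x₀, z₀) (h𝒦.prod hY₀) hU h0).contDiffWithinAt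

/-- **(A4-gen), global parameter** (`T = univ`). [cite: HormanderALPDO1, §1.1 Thm. 1.1.9 (p. 12)] [cite: DeitmarEchterhoff2014, Lemma 9.3.3] -/
theorem contDiffOn_integral_prod_descConj_fibre_of_uniformlyProper
    (M : Subgroup G) {c : V → G} (hcomm : ∀ x, ∀ m ∈ M, m * c x = c x * m)
    {S : Set V} (hS : IsOpen S)
    (hprop : ∀ K ⊆ S, IsCompact K → ∀ C : Set G, IsCompact C →
      ∃ 𝒦 : Set (G ⧸ M), IsCompact 𝒦 ∧ ∀ x ∈ K, ∀ y : G, y * c x * y⁻¹ ∈ C → (QuotientGroup.mk y : G ⧸ M) ∈ 𝒦)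
    [MeasurableSpace (G ⧸ M)] [OpensMeasurableSpace (G ⧸ M)] [T2Space (G ⧸ M)]
    (μ : Measure (G ⧸ M)) [IsFiniteMeasureOnCompacts μ] (ν : Measure Y) [IsFiniteMeasureOnCompacts ν] [SFinite ν]
    {Φ : V × Z → G → Y → F} {C : Set G} (hC : IsCompact C)
    (hΦC : ∀ q : V × Z, q.1 ∈ S → ∀ g ∉ C, ∀ η, Φ q g η = 0)
    (hfib : ∀ K : Set (V × Z), K ⊆ S ×ˢ univ → IsCompact K → ∃ Y₀ : Set Y, IsCompact Y₀ ∧ ∀ q ∈ K, ∀ g, ∀ η ∉ Y₀, Φ q g η = 0)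
    (p : G → P) (hp : Continuous p) (hpM : ∀ y, ∀ m ∈ M, p (y * m) = p y) (r : Y → Q) (hr : Continuous r)
    (Ψ : (P × Q) × (V × Z) → F) (hΨ : ContDiff ℝ ∞ Ψ) (hfac : ∀ q y η, Φ q (y * c q.1 * y⁻¹) η = Ψ ((p y, r η), q)) :
    ContDiffOn ℝ ∞ (fun q : V × Z => ∫ w : (G ⧸ M) × Y, descConj (c q.1) M (hcomm q.1) (fun g => Φ q g w.2) w.1 ∂(μ.prod ν)) (S ×ˢ univ) :=
  contDiffOn_integral_prod_descConj_fibre_of_uniformlyProper_local M hcomm hS hprop μ ν isOpen_univ hC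
    (fun q hq g hg η => hΦC q (mem_prod.1 hq).1 g hg η) hfib p hp hpM r hr Ψ hΨ hfac

/-- **(A4-gen) without parameter**: a fibred kernel `Φ : V → G → Y → F` ⇒ `x ↦ ∫_{(G ⧸ M) × Y} Φ x (y · c(x) · y⁻¹) η d(μ ⊗ λ)` is `ContDiffOn ℝ ∞` on `S`.
[cite: HormanderALPDO1, §1.1 Thm. 1.1.9 (p. 12)] [cite: Varadarajan1977, I §1.12] -/
theorem contDiffOn_integral_prod_descConj_fibre_of_uniformlyProper_of_param
    (M : Subgroup G) {c : V → G} (hcomm : ∀ x, ∀ m ∈ M, m * c x = c x * m)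
    {S : Set V} (hS : IsOpen S)
    (hprop : ∀ K ⊆ S, IsCompact K → ∀ C : Set G, IsCompact C →
      ∃ 𝒦 : Set (G ⧸ M), IsCompact 𝒦 ∧ ∀ x ∈ K, ∀ y : G, y * c x * y⁻¹ ∈ C → (QuotientGroup.mk y : G ⧸ M) ∈ 𝒦)
    [MeasurableSpace (G ⧸ M)] [OpensMeasurableSpace (G ⧸ M)] [T2Space (G ⧸ M)]
    (μ : Measure (G ⧸ M)) [IsFiniteMeasureOnCompacts μ] (ν : Measure Y) [IsFiniteMeasureOnCompacts ν] [SFinite ν]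
    {Φ : V → G → Y → F} {C : Set G} (hC : IsCompact C)
    (hΦC : ∀ x ∈ S, ∀ g ∉ C, ∀ η, Φ x g η = 0)
    (hfib : ∀ K ⊆ S, IsCompact K → ∃ Y₀ : Set Y, IsCompact Y₀ ∧ ∀ x ∈ K, ∀ g, ∀ η ∉ Y₀, Φ x g η = 0)
    (p : G → P) (hp : Continuous p) (hpM : ∀ y, ∀ m ∈ M, p (y * m) = p y) (r : Y → Q) (hr : Continuous r)
    (Ψ : (P × Q) × V → F) (hΨ : ContDiff ℝ ∞ Ψ) (hfac : ∀ x y η, Φ x (y * c x * y⁻¹) η = Ψ ((p y, r η), x)) :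
    ContDiffOn ℝ ∞ (fun x : V => ∫ w : (G ⧸ M) × Y, descConj (c x) M (hcomm x) (fun g => Φ x g w.2) w.1 ∂(μ.prod ν)) S := by
  have h := contDiffOn_integral_prod_descConj_fibre_of_uniformlyProper_local (Z := ℝ) M hcomm hS hprop μ ν isOpen_univ
    (Φ := fun q : V × ℝ => Φ q.1) hC (fun q hq g hg η => hΦC q.1 (mem_prod.1 hq).1 g hg η)
    (fun K hKsub hK => by
      obtain ⟨Y₀, hY₀, h0⟩ := hfib (Prod.fst '' K) (fun x ⟨q, hq, hqx⟩ => hqx ▸ (mem_prod.1 (hKsub hq)).1) (hK.image continuous_fst)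
      exact ⟨Y₀, hY₀, fun q hq g η hη => h0 q.1 ⟨q, hq, rfl⟩ g η hη⟩)
    p hp hpM r hr (fun s : (P × Q) × (V × ℝ) => Ψ (s.1, s.2.1)) (hΨ.comp (contDiff_fst.prodMk (contDiff_fst.comp contDiff_snd)))
    (fun q y η => hfac q.1 y η)
  have hmaps : MapsTo (fun x : V => (x, (0 : ℝ))) S (S ×ˢ univ) := fun x hx => ⟨hx, mem_univ _⟩
  exact h.comp (contDiffOn_id.prodMk contDiffOn_const) hmaps

end FibreSmoothParam

end Literature.MeasureTheory.Group

end
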